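import Summits.AtomisticToContinuum.Crystallization.Theorems.FrustratedLawDichotomyStrainedPatchHomValueT2SoundI

/-!
# (I1) part J — FOLDED COORDINATES along the segment (roadmap R2b, second half): the real second-order moments `ν_kl` of a label in the kit's `memU`
# convention and ★ the second-order identity `‖ΔU q + V Δξ‖² + 2⟪Vq, ΔU Δξ⟫ = Σ_{k,l<9} ν_kl δ_k δ_l` for a SYMMETRIC `ΔU`
# (27623 `(H) HomFloor`, hcp half; decomp-a2c hand-1 g41; I1-ROADMAP-g41 §4 (ii)).

With `y(s) = (V + sΔU)(q + sΔξ)`: `y′(0) = ΔU q + V Δξ`, `y″ = 2 ΔU Δξ`, so the left-hand side is `‖y′‖² + ⟪y, y″⟫` — the `β`-part of the per-label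
Hessian form read along the segment (`…SoundF.hasDerivAt_Wslope_path`).  Real definitions (`dyR`, `ddyR`, `nuR`) + the identity; 0 sorry; standard axioms;
no instances / notation / `#eval`.  `--supports stmt-AtomisticToContinuum-27623`.
-/

noncomputable section

namespace Summit.AtomisticToContinuum.Crystallization.Theorems.FrustratedLawDichotomyStrainedPatchHomValueT2Kit

open scoped BigOperators RealInnerProductSpace
open Finset
open Literature.Analysis.ValidatedNumerics.Numerics
open Summit.AtomisticToContinuum.Crystallization.Theorems.ChargedEnergyGapNegative (E3)
open Summit.AtomisticToContinuum.Crystallization.Theorems.FrustratedLawDichotomyStrainedPatchHomCoords (apply_eq_sum_entries)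
open Summit.AtomisticToContinuum.Crystallization.Theorems.FrustratedLawDichotomyStrainedPatchHomLeafCalculus (inner_eq_sum_apply)

/-! ## §1. Real first and second derivatives of `y = Vq` in the folded coordinates -/

/-- `(∂_k y)_c`: for a `U`-coordinate the `q`-entries of its members, for `ξ_i` the column `V_{·i}` (junk `0` beyond `8`). -/
def dyR (V : E3 →L[ℝ] E3) (q : E3) (k : ℕ) (cc : Fin 3) : ℝ :=
  match k with
  | 0 => if cc = 0 then q 0 else 0
  | 1 => if cc = 1 then q 1 else 0
  | 2 => if cc = 2 then q 2 else 0
  | 3 => (if cc = 0 then q 1 else 0) + (if cc = 1 then q 0 else 0)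
  | 4 => (if cc = 0 then q 2 else 0) + (if cc = 2 then q 0 else 0)
  | 5 => (if cc = 1 then q 2 else 0) + (if cc = 2 then q 1 else 0)
  | 6 => ent V cc 0
  | 7 => ent V cc 1
  | 8 => ent V cc 2
  | _ => 0

/-- `(∂_k ∂_l y)_c` for a `U`-coordinate `k < 6` and a `ξ`-coordinate `l = 6 + i` (constants `0/1`). -/
def ddyU (k : ℕ) (i : ℕ) (cc : Fin 3) : ℝ :=
  match k with
  | 0 => if cc = 0 ∧ i = 0 then 1 else 0
  | 1 => if cc = 1 ∧ i = 1 then 1 else 0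
  | 2 => if cc = 2 ∧ i = 2 then 1 else 0
  | 3 => (if cc = 0 ∧ i = 1 then 1 else 0) + (if cc = 1 ∧ i = 0 then 1 else 0)
  | 4 => (if cc = 0 ∧ i = 2 then 1 else 0) + (if cc = 2 ∧ i = 0 then 1 else 0)
  | 5 => (if cc = 1 ∧ i = 2 then 1 else 0) + (if cc = 2 ∧ i = 1 then 1 else 0)
  | _ => 0

/-- `(∂_k ∂_l y)_c` (symmetric; nonzero only for one `U`- and one `ξ`-coordinate). -/
def ddyR (k l : ℕ) (cc : Fin 3) : ℝ :=
  if k < 6 ∧ 6 ≤ l ∧ l < 9 then ddyU k (l - 6) cc else if l < 6 ∧ 6 ≤ k ∧ k < 9 then ddyU l (k - 6) cc else 0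

/-- ★ The real second-order moments `ν_kl = ∂_k y·∂_l y + y·∂_k∂_l y` (the kit's `nPat / mPat / utU` patterns). -/
def nuR (V : E3 →L[ℝ] E3) (q : E3) (k l : ℕ) : ℝ :=
  ∑ cc : Fin 3, (dyR V q k cc * dyR V q l cc + (V q) cc * ddyR k l cc)

/-! ## §2. The directional derivatives in coordinates -/

/-- ★ `(ΔU q + V Δξ)_c = Σ_{k<9} (∂_k y)_c δ_k` for a symmetric `ΔU`. [folklore: expansion in entries] -/
theorem dy_apply_eq_sum (V ΔU : E3 →L[ℝ] E3) (hsym : ∀ a b : Fin 3, ent ΔU a b = ent ΔU b a) (q Δξ : E3) (cc : Fin 3) :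
    (ΔU q + V Δξ) cc = ∑ k ∈ range 9, dyR V q k cc * dispN ΔU Δξ k := by
  have h10 := hsym 1 0
  have h20 := hsym 2 0
  have h21 := hsym 2 1
  simp only [ent] at h10 h20 h21
  simp only [Finset.sum_range_succ, Finset.sum_range_zero, zero_add, dyR, dispN, ent]
  rw [PiLp.add_apply, apply_eq_sum_entries ΔU q, apply_eq_sum_entries V Δξ]
  simp only [Fin.sum_univ_three]
  fin_cases cc <;> simp <;> (try rw [h10]) <;> (try rw [h20]) <;> (try rw [h21]) <;> ring

/-- ★ `(ΔU Δξ)_c = ½ Σ_{k,l<9} (∂_k∂_l y)_c δ_k δ_l` for a symmetric `ΔU`. [folklore] -/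
theorem ddy_apply_eq_sum (ΔU : E3 →L[ℝ] E3) (hsym : ∀ a b : Fin 3, ent ΔU a b = ent ΔU b a) (Δξ : E3) (cc : Fin 3) :
    2 * (ΔU Δξ) cc = ∑ k ∈ range 9, ∑ l ∈ range 9, ddyR k l cc * dispN ΔU Δξ k * dispN ΔU Δξ l := by
  have h10 := hsym 1 0
  have h20 := hsym 2 0
  have h21 := hsym 2 1
  simp only [ent] at h10 h20 h21
  simp only [Finset.sum_range_succ, Finset.sum_range_zero, zero_add, ddyR, ddyU, dispN, ent]
  rw [apply_eq_sum_entries ΔU Δξ]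
  simp only [Fin.sum_univ_three]
  fin_cases cc <;> simp +decide <;> (try rw [h10]) <;> (try rw [h20]) <;> (try rw [h21]) <;> ring

/-! ## §3. ★ The second-order identity -/

/-- ★★ **SECOND-ORDER IDENTITY**: `‖ΔU q + V Δξ‖² + 2⟪Vq, ΔU Δξ⟫ = Σ_{k,l<9} ν_kl(V, q)·δ_k δ_l` for a symmetric `ΔU`. [folklore] -/
theorem normSq_dy_add_inner_ddy_eq_sum (V ΔU : E3 →L[ℝ] E3) (hsym : ∀ a b : Fin 3, ent ΔU a b = ent ΔU b a) (q Δξ : E3) :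
    ‖ΔU q + V Δξ‖ ^ 2 + 2 * ⟪V q, ΔU Δξ⟫ = ∑ k ∈ range 9, ∑ l ∈ range 9, nuR V q k l * (dispN ΔU Δξ k * dispN ΔU Δξ l) := by
  -- both sides as `Σ_c [(Σ_k dy_k δ_k)_c² + y_c · Σ_kl ddy δ δ]`
  rw [← real_inner_self_eq_norm_sq (ΔU q + V Δξ), inner_eq_sum_apply, inner_eq_sum_apply, Finset.mul_sum]
  have lhs : ∑ cc : Fin 3, (ΔU q + V Δξ) cc * (ΔU q + V Δξ) cc + ∑ cc : Fin 3, 2 * ((V q) cc * (ΔU Δξ) cc) =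
      ∑ cc : Fin 3, ((∑ k ∈ range 9, dyR V q k cc * dispN ΔU Δξ k) * (∑ l ∈ range 9, dyR V q l cc * dispN ΔU Δξ l) +
        (V q) cc * ∑ k ∈ range 9, ∑ l ∈ range 9, ddyR k l cc * dispN ΔU Δξ k * dispN ΔU Δξ l) := by
    rw [← Finset.sum_add_distrib]
    refine Finset.sum_congr rfl fun cc _ => ?_
    rw [← dy_apply_eq_sum V ΔU hsym q Δξ cc, ← ddy_apply_eq_sum ΔU hsym Δξ cc]
    ring
  rw [lhs]
  -- reorganise the sums: per component, product of sums = double sum; then swap the component sum inside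
  have step : ∀ cc : Fin 3, (∑ k ∈ range 9, dyR V q k cc * dispN ΔU Δξ k) * (∑ l ∈ range 9, dyR V q l cc * dispN ΔU Δξ l) +
      (V q) cc * ∑ k ∈ range 9, ∑ l ∈ range 9, ddyR k l cc * dispN ΔU Δξ k * dispN ΔU Δξ l =
      ∑ k ∈ range 9, ∑ l ∈ range 9, (dyR V q k cc * dyR V q l cc + (V q) cc * ddyR k l cc) * (dispN ΔU Δξ k * dispN ΔU Δξ l) := by
    intro cc
    rw [Finset.sum_mul_sum, Finset.mul_sum, ← Finset.sum_add_distrib]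
    refine Finset.sum_congr rfl fun k _ => ?_
    rw [Finset.mul_sum, ← Finset.sum_add_distrib]
    refine Finset.sum_congr rfl fun l _ => ?_
    ring
  rw [Finset.sum_congr rfl (fun cc _ => step cc), Finset.sum_comm]
  refine Finset.sum_congr rfl fun k _ => ?_
  rw [Finset.sum_comm]
  refine Finset.sum_congr rfl fun l _ => ?_
  rw [nuR, Finset.sum_mul]

end Summit.AtomisticToContinuum.Crystallization.Theorems.FrustratedLawDichotomyStrainedPatchHomValueT2Kit
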